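import Mathlib
import Summits.ValiantsHypothesis.ValiantsHypothesis.Theses.FeketeSOS

/-!
# Sketch — crux ideas for `FeketeSOS.FeketeBoundedFanin` (stmt-ValiantsHypothesis-3998), ideator 3, round 1

First-lemma signatures for the two idea cards

* `log-monomial-gap`      : `FeketeMomentsDelta`, `GapPrinciple`, `SplitForm`, `MonomialProductBound`,
                            `NonCancellingReduction`, `Composition₁`
* `reciprocal-rigidity`   : `HajosExtremalUnique`, `BalancedUnitRigidity`, `ReciprocalRigidity`, `Composition₂`

Nothing here is proved; every declaration is a `Prop` (or a definition) and the file must elaborate.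
-/

namespace Summit.ValiantsHypothesis.ValiantsHypothesis.Cruxes.FeketeBoundedFanin.Ideator3

open Polynomial Finset BigOperators

/-- The Fekete polynomial with coefficients in a ring `R`: `Σ_{m<p} (m|p) X^m`. -/
noncomputable def fekete (R : Type*) [CommRing R] (p : ℕ) [Fact p.Prime] : Polynomial R :=
  ∑ m ∈ Finset.range p, C (((legendreSym p m : ℤ)) : R) * X ^ m

/-- Power moments of a polynomial's coefficient vector, exponents read in the coefficient ring:
`μ_l(P) = Σ_e P_e · e^l`.  In characteristic `p` (degree `< p`) these are, up to `l!`, the Taylor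
coefficients of `P(exp z)` — the "log-coordinate" expansion. -/
noncomputable def moment {R : Type*} [CommRing R] (P : Polynomial R) (l : ℕ) : R :=
  ∑ e ∈ P.support, P.coeff e * (e : R) ^ l

/-- MONOMIALISATION (Euler's criterion in log-coordinates): over a field of characteristic `p`,
the moments of the Fekete polynomial are a delta at `l = (p-1)/2`: `μ_l(F̄_p) = -[l = (p-1)/2]`
for `0 ≤ l ≤ p-2`.  Equivalently `F̄_p = -z^M/M!` in `k[z]/(z^p)`, `x = exp z`, `M = (p-1)/2`. -/
def FeketeMomentsDelta : Prop :=
  ∀ (k : Type) [Field k] (p : ℕ) [Fact p.Prime] [CharP k p], p ≠ 2 →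
    ∀ l : ℕ, l ≤ p - 2 →
      moment (fekete k p) l = if l = (p - 1) / 2 then (-1 : k) else 0

/-- GAP PRINCIPLE (uncertainty for the Mellin side; generalises the char-`p` Hajós lemma, which is
the case `l₀ = 0`): a nonzero polynomial of degree `< p` with `N` monomials and nonzero constant-free
support cannot have `N` consecutive vanishing moments `μ_{l₀}, …, μ_{l₀+N-1}` (all indices `≤ p-2`).
Proof sketch: `l ↦ μ_l` satisfies the linear recurrence with characteristic polynomial
`Π_{e ∈ supp}(T - e)`, whose roots are nonzero and distinct in `k ⊇ 𝔽_p`. -/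
def GapPrinciple : Prop :=
  ∀ (k : Type) [Field k] (p : ℕ) [Fact p.Prime] [CharP k p] (P : Polynomial k),
    P ≠ 0 → P.natDegree < p → P.coeff 0 = 0 →
    ∀ l₀ : ℕ, l₀ + P.support.card ≤ p - 1 →
      ∃ l, l₀ ≤ l ∧ l < l₀ + P.support.card ∧ moment P l ≠ 0

/-- SPLIT FORM: over `ℂ` every quadratic form is split, so `s₀` weighted squares are
`t = ⌈s₀/2⌉` products of pairs whose supports are no larger than the union of two of the original
supports: `Σ_{i<s₀} c_i g_i² = Σ_{j<t} A_j B_j` with `Σ_j (|A_j|+|B_j|) ≤ 2 Σ_i |g_i|`. -/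
def SplitForm : Prop :=
  ∀ (s₀ : ℕ) (c : Fin s₀ → ℂ) (g : Fin s₀ → Polynomial ℂ),
    ∃ (A B : Fin ((s₀ + 1) / 2) → Polynomial ℂ),
      (∑ j, A j * B j) = ∑ i, Polynomial.C (c i) * g i ^ 2 ∧
      (∀ j, (A j).natDegree ≤ Finset.sup Finset.univ (fun i => (g i).natDegree) ∧
            (B j).natDegree ≤ Finset.sup Finset.univ (fun i => (g i).natDegree)) ∧
      (∑ j, ((A j).support.card + (B j).support.card) : ℕ) ≤ 2 * ∑ i, (g i).support.card

/-- THE TRANSFER TARGET `C⁺(t)` (two-sided sparse-products-to-monomial bound, "SPM*_t"):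
in characteristic `p`, `t` products of polynomials of degree `< p` that sum, modulo `X^p - 1`,
to a NONZERO multiple of the Fekete polynomial (= the monomial `κ z^{(p-1)/2}` in log-coordinates)
have total support at least `p^{1/2+δ}`.  `t = 1` holds with the linear bound `(p+3)/2`
(sibling crux FeketeNoSparseSplit, idea `cyclic-valuation-dichotomy`). Conjecturally linear in `p`
for every fixed `t`. -/
def MonomialProductBound (t : ℕ) : Prop :=
  ∃ δ : ℝ, 0 < δ ∧ ∃ p₀ : ℕ, ∀ (p : ℕ) [Fact p.Prime], p₀ ≤ p →
    ∀ (k : Type) [Field k] [CharP k p] (A B : Fin t → Polynomial k) (κ : k),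
      κ ≠ 0 → (∀ j, (A j).natDegree < p ∧ (B j).natDegree < p) →
      (X ^ p - 1 : Polynomial k) ∣ (∑ j, A j * B j) - Polynomial.C κ * fekete k p →
      (p : ℝ) ^ (1 / 2 + δ) ≤ ∑ j, (((A j).support.card : ℝ) + ((B j).support.card : ℝ))

/-- NON-CANCELLING REDUCTION (the p-adic layer stub): a complex representation of `F_p` as a sum of
`t` products either has total support `≥ p` already, or reduces — at some prime over `p` of a number
field of definition, after per-factor primitive rescaling and cyclic folding — to a characteristic-`p`
representation of a NONZERO multiple of `F̄_p` with no larger supports.  For `t = 1` this is the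
sibling's `PrimitiveReduction` (always non-cancelling or trivially huge); for `t ≥ 2` the cancelling
layers (`Σ_j λ̄_j Ā_j B̄_j = 0`) must be descended — the one genuinely new infrastructural step. -/
def NonCancellingReduction (t : ℕ) : Prop :=
  ∀ (p : ℕ) [Fact p.Prime] (A B : Fin t → Polynomial ℂ),
    (∀ j, (A j).natDegree ≤ p ^ 2 ∧ (B j).natDegree ≤ p ^ 2) →
    (∑ j, A j * B j) = fekete ℂ p →
    (p : ℝ) ≤ ∑ j, (((A j).support.card : ℝ) + ((B j).support.card : ℝ)) ∨
    ∃ (k : Type) (_ : Field k) (_ : CharP k p) (A' B' : Fin t → Polynomial k) (κ : k),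
      κ ≠ 0 ∧ (∀ j, (A' j).natDegree < p ∧ (B' j).natDegree < p) ∧
      (X ^ p - 1 : Polynomial k) ∣ (∑ j, A' j * B' j) - Polynomial.C κ * fekete k p ∧
      (∀ j, (A' j).support.card ≤ (A j).support.card ∧ (B' j).support.card ≤ (B j).support.card)

/-- Composition of card 1 (`log-monomial-gap`): the two stubs for every `t`, plus the split form,
give the crux.  (Pure bookkeeping: `s₀` squares ↦ `t = ⌈s₀/2⌉` products with doubled support-sum,
reduce, apply `C⁺(t)`, halve `δ` to absorb the factor 2 and the `p`-versus-`p^{1/2+δ}` branch.) -/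
def Composition₁ : Prop :=
  SplitForm → (∀ t, MonomialProductBound t) → (∀ t, NonCancellingReduction t) →
    Summit.ValiantsHypothesis.ValiantsHypothesis.Theses.FeketeSOS.FeketeBoundedFanin

/-- HAJÓS-EXTREMAL UNIQUENESS (card 2's first checkable lemma = the Hanson–Petridis coefficients,
Rudnev–Tyrrell arXiv:2607.24270 Def 3.1 / Lemma 3.2, in polynomial clothing): a polynomial of degree `< p`
over a field of characteristic `p` that vanishes at `x = 1` to the maximal order its sparsity allows
(`|supp P| - 1`) is unique up to a scalar on its support, with coefficients `λ / Π_{n' ≠ n}(n - n')`.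
Consequence used by the line: at the counting threshold a product `U·V ≡ κ (mod (X-1)^N)` with all sums
of exponents distinct has the RANK-ONE pattern `a_e b_f = λ / ω'(e+f)` on `supp U × supp V`. -/
def HajosExtremalUnique : Prop :=
  ∀ (k : Type) [Field k] (p : ℕ) [Fact p.Prime] [CharP k p] (P : Polynomial k),
    P ≠ 0 → P.natDegree < p → ((X - 1) ^ (P.support.card - 1) : Polynomial k) ∣ P →
    ∃ c : k, ∀ n ∈ P.support, P.coeff n * ∏ n' ∈ P.support.erase n, ((n : k) - (n' : k)) = c

/-- BALANCED UNIT RIGIDITY (card 2's target; the hard case of `C⁺(2)` isolated): two products of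
polynomials of degree `< p` over a field of characteristic `p` whose sum is `κ (X-1)^N` modulo
`(X-1)^(N+L)` — i.e. `u₁v₁ + u₂v₂ = κ z^N + O(z^{N+L})`, a gap of length `N` below and `L` above —
have total support with a POWER SAVING over the counting threshold: `≥ min(N,L)^{1/2+δ}`.
(Conjecturally linear, `≥ c·min(N,L)`; the crux supplies `N = (p-1)/2 - m`, `L = (p-1)/2`.) -/
def BalancedUnitRigidity : Prop :=
  ∃ δ : ℝ, 0 < δ ∧ ∃ N₀ : ℕ, ∀ (k : Type) [Field k] (p : ℕ) [Fact p.Prime] [CharP k p]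
    (u₁ v₁ u₂ v₂ : Polynomial k) (κ : k) (N L : ℕ),
      κ ≠ 0 → N₀ ≤ min N L → N + L ≤ p - 1 →
      u₁.natDegree < p → v₁.natDegree < p → u₂.natDegree < p → v₂.natDegree < p →
      ((X - 1) ^ (N + L) : Polynomial k) ∣ (u₁ * v₁ + u₂ * v₂ - Polynomial.C κ * (X - 1) ^ N) →
      ((min N L : ℕ) : ℝ) ^ (1 / 2 + δ) ≤
        (u₁.support.card : ℝ) + (v₁.support.card : ℝ) + (u₂.support.card : ℝ) + (v₂.support.card : ℝ)

/-- RECIPROCAL RIGIDITY (the simplest member of the family, `u₂ = v₂ = 1`; its 0/1-instance at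
`N = (p-1)/2` contains Sárközy's conjecture = Kalmynin's theorem for large `p`): if the product of two
polynomials of degree `< p` is a nonzero CONSTANT to order `N` at `x = 1` without being that constant,
then `|supp U| + |supp V| ≥ N^{1/2+δ}` (counting/Hajós gives only `|U|·|V| ≥ N`; conjecturally `≥ c·N`). -/
def ReciprocalRigidity : Prop :=
  ∃ δ : ℝ, 0 < δ ∧ ∃ N₀ : ℕ, ∀ (k : Type) [Field k] (p : ℕ) [Fact p.Prime] [CharP k p]
    (U V : Polynomial k) (κ : k) (N : ℕ),
      κ ≠ 0 → N₀ ≤ N → N ≤ p - 1 → U.natDegree < p → V.natDegree < p →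
      ((X - 1) ^ N : Polynomial k) ∣ (U * V - Polynomial.C κ) → U * V ≠ Polynomial.C κ →
      (N : ℝ) ^ (1 / 2 + δ) ≤ (U.support.card : ℝ) + (V.support.card : ℝ)

/-- Composition of card 2 (`reciprocal-rigidity`) with card 1's pipeline at `t = 2`:
order bookkeeping (gap principle) settles every configuration except the balanced unit equation,
so `BalancedUnitRigidity` closes `C⁺(2)`, i.e. the crux for `s₀ ≤ 4` (and `s₀ = 5` via `W·W`)
modulo the reduction stub. -/
def Composition₂ : Prop :=
  GapPrinciple → FeketeMomentsDelta → HajosExtremalUnique → BalancedUnitRigidity → MonomialProductBound 2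

end Summit.ValiantsHypothesis.ValiantsHypothesis.Cruxes.FeketeBoundedFanin.Ideator3
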